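import Literature.MathematicalPhysics.QuantumFieldTheory.Balaban1983to89.B6RandomWalkL2Chain
import Literature.MathematicalPhysics.QuantumFieldTheory.Balaban1983to89.B6Prop26Gluing

/-!
# `Balaban1983to89.B6RandomWalkL2Gluing` — T. Bałaban, *Propagators and renormalization transformations for lattice gauge theories. II*,
# Commun. Math. Phys. **96** (1984) 223–250 [Balaban1984PropagatorsII], (2.90)–(2.91) p. 239 and (2.133)–(2.135), (2.141) p. 247 IN THE `L²` NORMS OF
# (2.140): gluing the per-cube `L²` legs `h_□G_□h_□` and the pair terms `K_{□,□′}G_{□′}h_{□′}` with the overlap count of the reaches, and Prop. 2.6's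
# `L²` entries END TO END from per-box inputs (the `ℓ²` twin of `B6Prop26Gluing`; file 4 of the block-`ℓ²` bricks of `…B6RandomWalkL2`)

statement-level skeleton of published theorems with citation tags; proofs where landed; nothing here is a claim about the Yang–Mills mass gap

WHAT IS PRINTED (p. 239 [PDF 17]): *"G₀ = Σ_{□∈𝒟} h_□G_□h_□ (2.90) … Δ_aG₀ = I − Σ_{□,□′∈𝒟} K_{□,□′}G_{□′}h_{□′} = I − R (2.91)"*; p. 247 [PDF 25] (render
`inprint/lit-balaban-p05/renders/cmp96/p25.png`): *"|(G_□J)(x)|, |(∇G_□J)(x)| ≤ O(1)[(Lʲη)², Lʲη]e^{−δ₂(Lʲη)⁻¹dist(Δ,Δ′)}|J| (2.133) for x ∈ Δ(y), supp J ⊂ Δ(y′),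
y, y′ ∈ 𝔅 ∩ T_□ … |(K_{□,□′}G_{□′}h_{□′}J)(x)| ≤ O(M⁻¹)e^{−½δ₂d(y,y′)}|J| (2.134) … and this together with (2.91) implies |(RJ)(x)| ≤ O(M⁻¹)e^{−½δ₂d(y,y′)}|J|
(2.135) … Reasoning in the same way as in the proof of Proposition 2.2 we obtain Proposition 2.6. … ‖ζGJ‖, ‖ζ∇GJ‖, ‖ζG∇*J‖, ‖ζ∇G∇*J‖, ‖ζ∇∇GJ‖, ‖ζG∇*∇*J‖
≤ O(1)[(Lʲη)², Lʲη, Lʲη, 1, 1, 1]|ζ|e^{−δ₃d(y,y′)}‖J‖ (2.140) … (2.141) and the series above is convergent in the norms appearing in the inequalities (2.136)–(2.140)."*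

CITATION HEADER (lean-in-tree rule) — WHAT IS REPRODUCED.  Phase-2 file of the `lit-balaban` typed skeleton (HOME `run/shared/lean/pub/lit-balaban/`), seat
**p22 gen 29** (free-target protocol G.5-34(d), TAKING HOME/STATUS 2026-08-24T13:26Z, cc r03); SKELETON row **B6.Prop2.6** × B6.Eq2.90-2.91 × B6.Eq2.133 ×
B6.Eq2.135 × B6.Eq2.141 (cells only; decls of record untouched).  `B6Prop26Gluing` (unit pv09) glues the SUP majorants of the per-box operators into the global
inputs `hG0`/`hR` of `B6RandomWalk.prop26_chain_2136`; THIS FILE does the same for the block-`ℓ²` majorants of `…B6RandomWalkL2` feeding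
`…B6RandomWalkL2Chain.prop26_chain_2140`, with `B6Prop26Gluing`'s vocabulary BY NAME (`mulOp`, `OutLoc`, `ind`, the overlap count `#{□ : y ∈ S_□} ≤ N`):
* §1 multiplication by `|h| ≤ 1` does not increase `ℓ²` sizes (`l2n_mulOp_le`), keeps block supports; **`hasL2Majorant_mul_mulOp`** / **`hasL2Majorant_mulOp_mul`**
  (right/left factors `h` with `|h| ≤ 1`), `hasL2Majorant_localise_out` (output localised to `S` ⇒ factor `1_S(y)`), `hasL2Majorant_localise_in` (a right
  factor `h` supported over the blocks of `S′` ⇒ factor `1_{S′}(y′)`);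
* §2 `hasL2Majorant_finsetSum` (*"A summation preserves it also"*), **`hasL2Majorant_sum_overlap`** (terms with majorants `1_{S_□}(y)·K` and overlap number `N`
  ⇒ the sum has `N·K`), `hasL2Majorant_sum_pairs_overlap` (`1_{S_□}(y)1_{S_□′}(y′)K` ⇒ `N²K`);
* §3 **`l2Majorant_G0_of_legs`** — `G₀ = Σ_□ T_□` (any per-box operators, e.g. `D·h_□G_□h_□` for a left factor `D`) with per-box block-`ℓ²` legs
  `1_{S_□}(y)·K` ⇒ `G₀` has `N·K` ((2.90) + (2.133) in `L²`); **`l2Majorant_R_of_2134`** — `R = Σ_{□,□′}K_{□,□′}G_{□′}h_{□′}` with block-`ℓ²` pair bounds `K`,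
  `K_{□,□′}G_{□′}` output-localised to `S_□` and `supp h_{□′}` over `S_□′` ⇒ `R` has `N²K` ((2.134) ⇒ (2.135) in `L²`);
* §4 **`prop26_2140_of_l2legs`** — END TO END: per-box `ℓ²` legs of the `G₀`-terms (`1_{S_□}(y)·A·P(y)·e^{−½δ₂d}`), `ℓ²` pair bounds `θ₀e^{−½δ₂d}` with the
  localisations, `G = G₀ + GR` ((2.91) for `G = Δ_a⁻¹`, or for `D·G` with `G₀ ↦ D·G₀`), Lemma 2.1 at the rate `½δ₂`, the located smallness `N²θ₀·c₁ < 1` ⇒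
  `HasL2Majorant G (const2136 d δ₂ α (N²θ₀) (N·A)·P(y)·e^{−δ₃d})` — the `L²` sentence after (2.141).
THEOREMS ONLY (no definition, no `def … : Prop`, no new hypothesis beyond the printed shapes); IMPORTS BY NAME; standard axioms.

HONEST SCOPE / DIVERGENCES.  (1) As `B6Prop26Gluing`: finite-dimensional bookkeeping; the per-box `ℓ²` legs ((1.114)-type member bounds transported to the
global lattice) and the `ℓ²` pair bounds (from (2.134) for the pair terms AND their transposes, `…B6RandomWalkL2Schur`) are hypotheses of the printed shape, to be
discharged by k-level member/transposition files — the remaining work of the unowned census slots (2.140)₄₋₆, NOT done here.  (2) Unweighted `ℓ²` sums on both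
sides; constants `N·A`, `N²θ₀` located as in GAPS G-pv09-1.  NOT summit progress.  Unit `lit-balaban-p22` (gen 29), 2026-08-24.
-/

noncomputable section

open scoped BigOperators
open Finset

namespace Literature.MathematicalPhysics.QuantumFieldTheory.Balaban1983to89.B6RandomWalkL2Gluing

open B6RandomWalk (blockPiece sum_blockPiece Ineq261 Ineq263 Triangle254 c1_nonneg const2136 delta3)
open B6RandomWalkL2 (l2n l2n_nonneg l2n_zero l2n_add_le l2n_sum_le l2n_mono l2n_blockPiece_le blockPiece_add blockPiece_sum blockPiece_eq_zero_of_ne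
  HasL2Majorant hasL2Majorant_mono hasL2Majorant_zero hasL2Majorant_add)
open B6RandomWalkL2Chain (prop26_chain_2140)
open B6Prop26Gluing (mulOp mulOp_apply OutLoc ind ind_nonneg ind_le_one ind_of_mem ind_of_not_mem sum_ind_eq_card)

variable {g : B6.Geometry} {X : Type} [Fintype X] (blk : X → g.Site)

/-! ## §1  Multiplication factors `|h| ≤ 1` and localisation in the block-`ℓ²` shape -/

section MulLoc

/-- `|h| ≤ 1 ⟹ ‖h·v‖ ≤ ‖v‖` and the same for every piece: `‖Δ(y)(h·v)‖ ≤ ‖Δ(y)v‖`. [cite: Balaban1984PropagatorsII, (2.36) p.229, (2.90) p.239 (bookkeeping, ours)] -/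
theorem l2n_blockPiece_mulOp_le {h : X → ℝ} (hle : ∀ x, |h x| ≤ 1) (y : g.Site) (v : X → ℝ) :
    l2n (blockPiece blk y (mulOp h v)) ≤ l2n (blockPiece blk y v) :=
  l2n_mono fun x => by
    by_cases hx : blk x = y
    · simp only [blockPiece, hx, if_true, mulOp_apply, abs_mul]
      calc |h x| * |v x| ≤ 1 * |v x| := mul_le_mul_of_nonneg_right (hle x) (abs_nonneg _)
        _ = |v x| := one_mul _
    · simp [blockPiece, hx]

omit [Fintype X] in
/-- `h·u` is supported where `u` is. [cite: Balaban1984PropagatorsII, (2.90) p.239 (bookkeeping, ours)] -/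
theorem mulOp_off {h u : X → ℝ} {y' : g.Site} (hu : ∀ x, blk x ≠ y' → u x = 0) : ∀ x, blk x ≠ y' → mulOp h u x = 0 :=
  fun x hx => by rw [mulOp_apply, hu x hx, mul_zero]

/-- `|h| ≤ 1 ⟹ ‖h·u‖ ≤ ‖u‖`. [cite: Balaban1984PropagatorsII, (2.36) p.229 (bookkeeping, ours)] -/
theorem l2n_mulOp_le {h : X → ℝ} (hle : ∀ x, |h x| ≤ 1) (u : X → ℝ) : l2n (mulOp h u) ≤ l2n u :=
  l2n_mono fun x => by
    rw [mulOp_apply, abs_mul]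
    calc |h x| * |u x| ≤ 1 * |u x| := mul_le_mul_of_nonneg_right (hle x) (abs_nonneg _)
      _ = |u x| := one_mul _

/-- a RIGHT factor `h` with `|h| ≤ 1` does not increase a block-`ℓ²` majorant `K ≥ 0`. [cite: Balaban1984PropagatorsII, (2.90)–(2.91) p.239 (bookkeeping, ours)] -/
theorem hasL2Majorant_mul_mulOp {T : Module.End ℝ (X → ℝ)} {K : g.Site → g.Site → ℝ} {h : X → ℝ}
    (hT : HasL2Majorant blk T K) (hK : ∀ a b, 0 ≤ K a b) (hle : ∀ x, |h x| ≤ 1) : HasL2Majorant blk (T * mulOp h) K := by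
  intro y y' u hu
  rw [Module.End.mul_apply]
  exact (hT y y' (mulOp h u) (mulOp_off blk hu)).trans (mul_le_mul_of_nonneg_left (l2n_mulOp_le hle u) (hK y y'))

/-- a LEFT factor `h` with `|h| ≤ 1` does not increase a block-`ℓ²` majorant. [cite: Balaban1984PropagatorsII, (2.90)–(2.91) p.239 (bookkeeping, ours)] -/
theorem hasL2Majorant_mulOp_mul {T : Module.End ℝ (X → ℝ)} {K : g.Site → g.Site → ℝ} {h : X → ℝ}
    (hT : HasL2Majorant blk T K) (hle : ∀ x, |h x| ≤ 1) : HasL2Majorant blk (mulOp h * T) K := by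
  intro y y' u hu
  rw [Module.End.mul_apply]
  exact (l2n_blockPiece_mulOp_le blk hle y (T u)).trans (hT y y' u hu)

/-- OUTPUT LOCALISATION improves a block-`ℓ²` majorant `K ≥ 0` by the factor `1_S(y)`: if `(Tv)(x) = 0` off the blocks of `S`, then `Δ(y)Tv = 0` for `y ∉ S`.
[cite: Balaban1984PropagatorsII, (2.92)–(2.93) p.239 (bookkeeping, ours)] -/
theorem hasL2Majorant_localise_out {T : Module.End ℝ (X → ℝ)} {K : g.Site → g.Site → ℝ} {S : Set g.Site}
    (hT : HasL2Majorant blk T K) (hK : ∀ a b, 0 ≤ K a b) (hout : OutLoc blk T S) :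
    HasL2Majorant blk T (fun a b => ind S a * K a b) := by
  intro y y' u hu
  beta_reduce
  by_cases hy : y ∈ S
  · rw [ind_of_mem hy, one_mul]; exact hT y y' u hu
  · have h0 : blockPiece blk y (T u) = 0 := by
      funext x
      by_cases hx : blk x = y
      · have : blk x ∉ S := by rw [hx]; exact hy
        simp [blockPiece, hx, hout u x this]
      · simp [blockPiece, hx]
    rw [h0, l2n_zero]
    exact mul_nonneg (mul_nonneg (ind_nonneg _ _) (hK _ _)) (l2n_nonneg u)

omit [Fintype X] in
/-- a right factor `h` supported over the blocks of `S′` kills inputs supported in a block outside `S′`. [cite: Balaban1984PropagatorsII, (2.91) p.239 (bookkeeping, ours)] -/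
theorem mulOp_eq_zero_of_support {h u : X → ℝ} {S' : Set g.Site} {y' : g.Site} (hsupp : ∀ x, h x ≠ 0 → blk x ∈ S')
    (hu : ∀ x, blk x ≠ y' → u x = 0) (hy' : y' ∉ S') : mulOp h u = 0 := by
  funext x
  rw [mulOp_apply, Pi.zero_apply]
  by_cases hx : blk x = y'
  · have h0 : h x = 0 := by
      by_contra hne
      exact hy' (hx ▸ hsupp x hne)
    rw [h0, zero_mul]
  · rw [hu x hx, mul_zero]

/-- INPUT LOCALISATION by a right factor: if `h` (with `|h| ≤ 1`) is supported over the blocks of `S′`, then `T·h` has the block-`ℓ²` majorant `1_{S′}(y′)·K(y,y′)`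
from `T`'s `K ≥ 0`. [cite: Balaban1984PropagatorsII, (2.91) p.239 (bookkeeping, ours)] -/
theorem hasL2Majorant_localise_in {T : Module.End ℝ (X → ℝ)} {K : g.Site → g.Site → ℝ} {h : X → ℝ} {S' : Set g.Site}
    (hT : HasL2Majorant blk T K) (hK : ∀ a b, 0 ≤ K a b) (hle : ∀ x, |h x| ≤ 1) (hsupp : ∀ x, h x ≠ 0 → blk x ∈ S') :
    HasL2Majorant blk (T * mulOp h) (fun a b => ind S' b * K a b) := by
  intro y y' u hu
  beta_reduce
  by_cases hy' : y' ∈ S'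
  · rw [ind_of_mem hy', one_mul]; exact hasL2Majorant_mul_mulOp blk hT hK hle y y' u hu
  · rw [Module.End.mul_apply, mulOp_eq_zero_of_support blk hsupp hu hy', map_zero]
    have h0 : blockPiece blk y (0 : X → ℝ) = 0 := by funext x; by_cases hx : blk x = y <;> simp [blockPiece, hx]
    rw [h0, l2n_zero]
    exact mul_nonneg (mul_nonneg (ind_nonneg _ _) (hK _ _)) (l2n_nonneg u)

end MulLoc

/-! ## §2  Finite sums with bounded overlap -/

section Overlap

/-- *"A summation preserves it also"* (p. 232) over any finite index set. [cite: Balaban1984PropagatorsII, p.232 (after (2.52))] -/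
theorem hasL2Majorant_finsetSum {C : Type} (D : Finset C) (T : C → Module.End ℝ (X → ℝ)) (K : C → g.Site → g.Site → ℝ)
    (h : ∀ c ∈ D, HasL2Majorant blk (T c) (K c)) : HasL2Majorant blk (∑ c ∈ D, T c) (fun a b => ∑ c ∈ D, K c a b) := by
  classical
  induction D using Finset.induction_on with
  | empty => simpa using hasL2Majorant_zero blk
  | insert c D hc ih =>
      have h' := hasL2Majorant_add blk (h c (Finset.mem_insert_self c D)) (ih fun c' hc' => h c' (Finset.mem_insert_of_mem hc'))
      intro y y' u hu
      have := h' y y' u hu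
      simpa [Finset.sum_insert hc] using this

open Classical in
/-- **BOUNDED-OVERLAP GLUING IN `L²`, single sum** (behind *"G₀ = Σ_□ h_□G_□h_□"*): terms with block-`ℓ²` majorants `1_{S_□}(y)·K(y,y′)`, common `K ≥ 0`, every
block in at most `N` reach sets ⇒ the sum has `N·K`. [cite: Balaban1984PropagatorsII, (2.90) p.239 with (2.133) p.247 (derivation ours)] -/
theorem hasL2Majorant_sum_overlap {C : Type} (D : Finset C) (S : C → Set g.Site) (T : C → Module.End ℝ (X → ℝ))
    (K : g.Site → g.Site → ℝ) (hK : ∀ a b, 0 ≤ K a b) (hT : ∀ c ∈ D, HasL2Majorant blk (T c) (fun a b => ind (S c) a * K a b))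
    (N : ℕ) (hN : ∀ a : g.Site, (D.filter fun c => a ∈ S c).card ≤ N) :
    HasL2Majorant blk (∑ c ∈ D, T c) (fun a b => N * K a b) := by
  refine hasL2Majorant_mono blk (hasL2Majorant_finsetSum blk D T _ hT) fun a b => ?_
  show ∑ c ∈ D, ind (S c) a * K a b ≤ N * K a b
  rw [← Finset.sum_mul, sum_ind_eq_card]
  exact mul_le_mul_of_nonneg_right (by exact_mod_cast hN a) (hK a b)

open Classical in
/-- **BOUNDED-OVERLAP GLUING IN `L²`, double sum** (behind *"this together with (2.91) implies (2.135)"*): pair terms with block-`ℓ²` majorants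
`1_{S_□}(y)·1_{S_□′}(y′)·K(y,y′)` ⇒ the double sum has `N²·K`. [cite: Balaban1984PropagatorsII, (2.91) p.239 with (2.134)–(2.135) p.247 (derivation ours)] -/
theorem hasL2Majorant_sum_pairs_overlap {C : Type} (D : Finset C) (S : C → Set g.Site) (T : C → C → Module.End ℝ (X → ℝ))
    (K : g.Site → g.Site → ℝ) (hK : ∀ a b, 0 ≤ K a b)
    (hT : ∀ c ∈ D, ∀ c' ∈ D, HasL2Majorant blk (T c c') (fun a b => ind (S c) a * ind (S c') b * K a b))
    (N : ℕ) (hN : ∀ a : g.Site, (D.filter fun c => a ∈ S c).card ≤ N) :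
    HasL2Majorant blk (∑ c ∈ D, ∑ c' ∈ D, T c c') (fun a b => (N : ℝ) ^ 2 * K a b) := by
  have hNa : ∀ a : g.Site, ∑ c ∈ D, ind (S c) a ≤ N := fun a => by
    rw [sum_ind_eq_card]
    exact_mod_cast hN a
  have hinner : ∀ c ∈ D, HasL2Majorant blk (∑ c' ∈ D, T c c') (fun a b => ind (S c) a * (N * K a b)) := by
    intro c hc
    refine hasL2Majorant_mono blk (hasL2Majorant_finsetSum blk D (T c) _ (hT c hc)) fun a b => ?_
    show ∑ c' ∈ D, ind (S c) a * ind (S c') b * K a b ≤ ind (S c) a * (N * K a b)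
    have : ∑ c' ∈ D, ind (S c) a * ind (S c') b * K a b = ind (S c) a * K a b * ∑ c' ∈ D, ind (S c') b := by
      rw [Finset.mul_sum]; exact Finset.sum_congr rfl fun c' _ => by ring
    rw [this]
    calc ind (S c) a * K a b * ∑ c' ∈ D, ind (S c') b ≤ ind (S c) a * K a b * N :=
          mul_le_mul_of_nonneg_left (hNa b) (mul_nonneg (ind_nonneg _ _) (hK a b))
      _ = ind (S c) a * (N * K a b) := by ring
  refine hasL2Majorant_mono blk (hasL2Majorant_sum_overlap blk D S _ (fun a b => N * K a b)
    (fun a b => mul_nonneg (Nat.cast_nonneg N) (hK a b)) hinner N hN) fun a b => le_of_eq ?_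
  ring

end Overlap

/-! ## §3  (2.90) + (2.133) and (2.91) + (2.134) ⇒ (2.135), in the block-`ℓ²` shape -/

section GZeroR

open Classical in
/-- **`G₀ = Σ_□ T_□` IN `L²`** ((2.90) with the per-box `L²` legs): per-box block-`ℓ²` majorants `1_{S_□}(y)·K(y,y′)` (e.g. of `D·h_□G_□h_□` for a left factor `D`,
from the member (1.114) bounds) and the overlap number `N` give `HasL2Majorant (Σ_□ T_□) (N·K)`. [cite: Balaban1984PropagatorsII, (2.90) p.239 + (2.133) p.247, (2.141) p.247] -/
theorem l2Majorant_G0_of_legs {C : Type} (D : Finset C) (S : C → Set g.Site) (N : ℕ)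
    (hN : ∀ a : g.Site, (D.filter fun c => a ∈ S c).card ≤ N) (T : C → Module.End ℝ (X → ℝ))
    (K : g.Site → g.Site → ℝ) (hK : ∀ a b, 0 ≤ K a b) (hlegs : ∀ c ∈ D, HasL2Majorant blk (T c) (fun a b => ind (S c) a * K a b)) :
    HasL2Majorant blk (∑ c ∈ D, T c) (fun a b => N * K a b) :=
  hasL2Majorant_sum_overlap blk D S T K hK hlegs N hN

open Classical in
/-- **(2.134) + (2.91) ⟹ (2.135) IN `L²`**: if every pair term `K_{□,□′}G_{□′}·h_{□′}` has the block-`ℓ²` majorant `K ≥ 0` (from the sup bounds (2.134) of the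
term and of its transpose, `…B6RandomWalkL2Schur`), the factor `K_{□,□′}G_{□′}` is output-localised to the reach `S_□` ((2.92)–(2.93)) and `h_{□′}` (`|h_{□′}| ≤ 1`)
is supported over the blocks of `S_□′`, then `R = Σ_{□,□′}K_{□,□′}G_{□′}h_{□′}` has the block-`ℓ²` majorant `N²·K`.
[cite: Balaban1984PropagatorsII, (2.91)–(2.93) p.239 + (2.134)–(2.135) p.247] -/
theorem l2Majorant_R_of_2134 {C : Type} (D : Finset C) (S : C → Set g.Site) (N : ℕ)
    (hN : ∀ a : g.Site, (D.filter fun c => a ∈ S c).card ≤ N)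
    (h : C → X → ℝ) (hsupp : ∀ c ∈ D, ∀ x, h c x ≠ 0 → blk x ∈ S c) (hle : ∀ c ∈ D, ∀ x, |h c x| ≤ 1)
    (Kt : C → C → Module.End ℝ (X → ℝ)) (K : g.Site → g.Site → ℝ) (hK : ∀ a b, 0 ≤ K a b)
    (h2134 : ∀ c ∈ D, ∀ c' ∈ D, HasL2Majorant blk (Kt c c') K)
    (hKout : ∀ c ∈ D, ∀ c' ∈ D, OutLoc blk (Kt c c') (S c)) :
    HasL2Majorant blk (∑ c ∈ D, ∑ c' ∈ D, Kt c c' * mulOp (h c')) (fun a b => (N : ℝ) ^ 2 * K a b) := by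
  refine hasL2Majorant_sum_pairs_overlap blk D S _ K hK (fun c hc c' hc' => ?_) N hN
  have h1 : HasL2Majorant blk (Kt c c' * mulOp (h c')) (fun a b => ind (S c') b * K a b) :=
    hasL2Majorant_localise_in blk (h2134 c hc c' hc') hK (hle c' hc') (hsupp c' hc')
  have h2 := hasL2Majorant_localise_out blk h1 (fun a b => mul_nonneg (ind_nonneg _ _) (hK a b))
    (B6Prop26Gluing.outLoc_mul blk (hKout c hc c' hc') _)
  exact hasL2Majorant_mono blk h2 fun a b => le_of_eq (by ring)

end GZeroR

/-! ## §4  End to end: the `L²` entries of (2.140) from per-box `ℓ²` legs, `ℓ²` pair bounds, (2.91) and Lemma 2.1 -/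

section EndToEnd

open Classical in
/-- **Prop. 2.6, an `L²` entry of (2.140), from the PER-BOX inputs** (p. 247, *"the series above is convergent in the norms appearing in the inequalities
(2.136)–(2.140)"*): boxes `𝒟` with reaches `S_□` of overlap number `N`; per-box operators `T_□` (the `G₀`-terms, e.g. `D·h_□G_□h_□`) with block-`ℓ²` legs
`1_{S_□}(y)·A·P(y)·e^{−½δ₂d(y,y′)}`; pair operators `K_{□,□′}G_{□′}` output-localised to `S_□`, with `h_{□′}` (`|h_{□′}| ≤ 1`, supported over `S_□′`) and the block-`ℓ²`
bound `θ₀e^{−½δ₂d}` of `K_{□,□′}G_{□′}h_{□′}`-without-`h` … i.e. of `K_{□,□′}G_{□′}`; `G₀ = Σ_□ T_□`, `R = Σ_{□,□′}K_{□,□′}G_{□′}h_{□′}` and `G = G₀ + GR`; Lemma 2.1 at the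
rate `½δ₂`, (2.54), `d(y,y) = 0`, `d ≥ 0` and the located smallness `N²θ₀·c₁(d, ½δ₂, α) < 1` ⇒ `G` has the block-`ℓ²` majorant
`const2136 d δ₂ α (N²θ₀) (N·A)·P(y)·e^{−δ₃d(y,y′)}`, `δ₃ = delta3 α δ₂`. [cite: Balaban1984PropagatorsII, Prop. 2.6 (2.140)–(2.141) p.247; (2.90)–(2.91) p.239; (2.133)–(2.135) p.247] -/
theorem prop26_2140_of_l2legs [DecidableEq X] (d : ℕ) (δ₂ α θ₀ A : ℝ) (P : g.Site → ℝ)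
    (hA : 0 ≤ A) (hP : ∀ y, 0 ≤ P y) (hθ₀ : 0 ≤ θ₀) (hα : α ≤ 1) (hδ₂ : 0 ≤ δ₂)
    (htri : Triangle254 g) (hrefl : ∀ y : g.Site, g.dist y y = 0) (hdnn : ∀ y y' : g.Site, 0 ≤ g.dist y y')
    (h261 : Ineq261 d g (δ₂ / 2) α) (h263 : Ineq263 d g (δ₂ / 2) α)
    {C : Type} (D : Finset C) (S : C → Set g.Site) (N : ℕ) (hN : ∀ a : g.Site, (D.filter fun c => a ∈ S c).card ≤ N)
    (hsmall : ((N : ℝ) ^ 2 * θ₀) * B6.c1 d (δ₂ / 2) α < 1)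
    (T : C → Module.End ℝ (X → ℝ))
    (hlegs : ∀ c ∈ D, HasL2Majorant blk (T c) (fun a b => ind (S c) a * (A * P a * Real.exp (-(δ₂ / 2 * g.dist a b)))))
    (h : C → X → ℝ) (hsupp : ∀ c ∈ D, ∀ x, h c x ≠ 0 → blk x ∈ S c) (hle : ∀ c ∈ D, ∀ x, |h c x| ≤ 1)
    (Kt : C → C → Module.End ℝ (X → ℝ))
    (h2134 : ∀ c ∈ D, ∀ c' ∈ D, HasL2Majorant blk (Kt c c') (fun a b => θ₀ * Real.exp (-(δ₂ / 2 * g.dist a b))))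
    (hKout : ∀ c ∈ D, ∀ c' ∈ D, OutLoc blk (Kt c c') (S c))
    {G G0 R : Module.End ℝ (X → ℝ)} (hG0 : G0 = ∑ c ∈ D, T c) (hR : R = ∑ c ∈ D, ∑ c' ∈ D, Kt c c' * mulOp (h c'))
    (hfix : G = G0 + G * R) :
    HasL2Majorant blk G (fun a b => const2136 d δ₂ α ((N : ℝ) ^ 2 * θ₀) (N * A) * P a * Real.exp (-(delta3 α δ₂ * g.dist a b))) := by
  have hKG : ∀ a b : g.Site, 0 ≤ A * P a * Real.exp (-(δ₂ / 2 * g.dist a b)) := fun a b =>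
    mul_nonneg (mul_nonneg hA (hP a)) (Real.exp_nonneg _)
  have hKR : ∀ a b : g.Site, 0 ≤ θ₀ * Real.exp (-(δ₂ / 2 * g.dist a b)) := fun a b => mul_nonneg hθ₀ (Real.exp_nonneg _)
  have hG0' : HasL2Majorant blk G0 (fun a b => (N * A) * P a * Real.exp (-(δ₂ / 2 * g.dist a b))) := by
    rw [hG0]
    refine hasL2Majorant_mono blk (l2Majorant_G0_of_legs blk D S N hN T _ hKG hlegs) fun a b => le_of_eq ?_
    ring
  have hR' : HasL2Majorant blk R (fun a b => ((N : ℝ) ^ 2 * θ₀) * Real.exp (-(δ₂ / 2 * g.dist a b))) := by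
    rw [hR]
    refine hasL2Majorant_mono blk (l2Majorant_R_of_2134 blk D S N hN h hsupp hle Kt _ hKR h2134 hKout) fun a b => le_of_eq ?_
    ring
  exact prop26_chain_2140 blk d δ₂ α ((N : ℝ) ^ 2 * θ₀) (N * A) P (mul_nonneg (Nat.cast_nonneg N) hA) hP
    (mul_nonneg (sq_nonneg _) hθ₀) hα hδ₂ htri hrefl hdnn h261 h263 hsmall hG0' hR' hfix

end EndToEnd

end Literature.MathematicalPhysics.QuantumFieldTheory.Balaban1983to89.B6RandomWalkL2Gluing
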